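import Mathlib
import Summits.NavierStokesRegularity.NavierStokesRegularity.Theses.FilamentSkeletonRss

/-!
# STUB R from a COKERNEL CERTIFICATE: the duality interface for route (ii′) of the 23612 repair census
# (crux `Clause13RNearStraightL`, stmt-NavierStokesRegularity-23612; line `rate_bordered_split`, STUB R `stub_rateRow13RFlat`)

Route `FilamentSkeletonRss`, Variant A1R.  The registered STUB R (`RateRow13RFlat`, text verbatim from
`Cruxes/Clause13RNearStraightL/Lines/rate_bordered_split.lean` 098fbcf79f64745c) is exact transversality of the rate column
`R_j(τ) = e₃ × X_jτ − ⟪e₃ × X_jτ, X_j′τ⟫X_j′τ` to the range of the linearised map `DT` on the clamped admissible test class, with zero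
`Y`-information (hand fsrs-8-g0: `…Clause13RHomogeneity`, `…Clause13RTransversality`).  The route that survives the structural analysis (memo
STRUCTURE-23612-conformal-cokernel-leafhand8-g1.md, evidence #29 on 23612) is DUALITY: an exact annihilator `ψ` of `range DT` on the tangency
balls with a pairing floor against `R_j`.  THIS FILE fixes that interface BY NAME against the registered text:

* `rateRow13RFlat_of_cokernelCertificate` — **COKERNEL CERTIFICATE ⟹ STUB R (verbatim)**, where the certificate is the STUB R text with the
  prefix `∀ b` dropped and the test-field tail replaced by: there is `ψ : Fin N → ℝ → ℝ³`, continuous, with POSITIVE mass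
  `M = Σ_j ∫_{S_j} ‖ψ_j‖` on the balls `S_j = {τ : ‖X_jτ‖ ≤ R_b√(Γ log Γ)}`, PAIRING FLOOR `(√Γ/cnd)·M ≤ Σ_j ∫_{S_j} ⟪ψ_j, R_j⟫`, and EXACT
  ANNIHILATION `Σ_j ∫_{S_j} ⟪ψ_j, DT·Y_j⟫ = 0` (with integrability) for every admissible `Y` (`C²`, normal, zero off the balls, phase-orthogonal —
  no envelope).  Proof: `dα·Σ∫⟪ψ,R⟫ = Σ∫⟪ψ, dα R − DT·Y⟫ + 0`, `|Σ∫⟪ψ, dα R − DT·Y⟫| ≤ L·M` by the in-ball defect bound, and `M > 0`.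
  Only clause 3 (`C²`, cocompact growth ⇒ the balls are compact: `isCompact_ball_of_cocompact`) is inspected; `u, v, A, T` are never unfolded.

So the open content of STUB R is EXACTLY the construction of such a `ψ` (near the tilt mode `τ·(e₃ × d)`, see the memo: a local solution of the adjoint
equation on the balls with quantitative near-affinity) — items (a)–(d) of the memo's census; this file is item (e).

Hand `leafhand-ns-filamentskeletonrs-8-g1` (LAND-ONLY); `--supports stmt-NavierStokesRegularity-23612` helper.  HONEST FRAMING: soft duality bookkeeping
about the registered statement of a clause on a HYPOTHETICAL near-straight filament skeleton on the NEGATIVE side of a MODEL blow-up route; STUB R is NOT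
proved here (the certificate is the open part), and nothing in this file bears on Navier–Stokes regularity or blow-up.
-/

noncomputable section

open Real Filter MeasureTheory Literature.Analysis.FluidPDE
open scoped RealInnerProductSpace InnerProductSpace Topology BigOperators

namespace Summit.NavierStokesRegularity.NavierStokesRegularity.Theorems.Clause13RCokernelCertificate
set_option linter.dupNamespace false

/-! ## §1 Soft lemmas -/

/-- The tangency ball `{τ : ‖X τ‖ ≤ ℓ}` of a continuous curve with `‖X τ‖ → ∞` along the cocompact filter is compact. [folklore] -/
theorem isCompact_ball_of_cocompact {E : Type*} [NormedAddCommGroup E] {X : ℝ → E} (hXc : Continuous X)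
    (hX : Tendsto (fun τ => ‖X τ‖) (cocompact ℝ) atTop) (ℓ : ℝ) : IsCompact {τ : ℝ | ‖X τ‖ ≤ ℓ} := by
  obtain ⟨K, hK, hKsub⟩ := mem_cocompact.1 (hX.eventually (eventually_gt_atTop ℓ))
  refine hK.of_isClosed_subset (isClosed_le (continuous_norm.comp hXc) continuous_const) ?_
  intro τ hτ
  by_contra hn
  have h' : ℓ < ‖X τ‖ := hKsub hn
  exact not_lt.2 hτ h'

/-- The ball is measurable (closed). [folklore] -/
theorem measurableSet_ball {E : Type*} [NormedAddCommGroup E] {X : ℝ → E} (hXc : Continuous X) (ℓ : ℝ) :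
    MeasurableSet {τ : ℝ | ‖X τ‖ ≤ ℓ} :=
  (isClosed_le (continuous_norm.comp hXc) continuous_const).measurableSet

/-- The rate-column field `τ ↦ e₃ × X τ − ⟪e₃ × X τ, X′τ⟫ • X′τ` of a `C²` curve is continuous. [folklore] -/
theorem continuous_rateColumn {X : ℝ → EuclideanSpace ℝ (Fin 3)} (hX : ContDiff ℝ 2 X) :
    Continuous fun τ => cross (EuclideanSpace.single 2 1) (X τ)
      - ⟪cross (EuclideanSpace.single 2 1) (X τ), deriv X τ⟫_ℝ • deriv X τ := by
  have hXc : Continuous X := hX.continuous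
  have hd : Continuous (deriv X) := hX.continuous_deriv (by norm_num)
  have hc : Continuous fun τ => cross (EuclideanSpace.single 2 1) (X τ) :=
    (crossCLM (EuclideanSpace.single 2 1 : EuclideanSpace ℝ (Fin 3))).continuous.comp hXc
  have hi : Continuous fun τ => ⟪cross (EuclideanSpace.single 2 1) (X τ), deriv X τ⟫_ℝ := hc.inner hd
  have hs : Continuous fun τ => ⟪cross (EuclideanSpace.single 2 1) (X τ), deriv X τ⟫_ℝ • deriv X τ := hi.smul hd
  exact hc.sub hs

/-! ## §2 The interface theorem -/

/-- **COKERNEL CERTIFICATE ⟹ STUB R** (`RateRow13RFlat` of the registered line, verbatim conclusion).  The hypothesis is the STUB R text with `∀ b`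
dropped and the test-field tail replaced by the existence of a continuous `ψ` on the tangency balls with positive mass, pairing floor `√Γ/cnd` against the
rate column, and exact (integrable) annihilation of `DT·Y` for every admissible `Y`. [folklore] -/
theorem rateRow13RFlat_of_cokernelCertificate :
    ((open Literature.Analysis.FluidPDE in ∀ (N : ℕ) (δ ρ K Λ Rw cg θ₀ KA : ℝ), 0 < N → 0 < δ → 0 < ρ → 0 < Rw → 0 < cg → 0 < θ₀ → ∃ Rb₀ : ℝ, 0 < Rb₀ ∧ ∀ Rb : ℝ, 0 < Rb → Rb ≤ Rb₀ → ∃ (cnd Γ₀ : ℝ), 0 < cnd ∧ ∀ Γ : ℝ, Γ₀ ≤ Γ → ∀ (γ : Fin N → ℝ) (α : ℝ) (X : Fin N → ℝ → EuclideanSpace ℝ (Fin 3)) (w : Fin N → ℝ → ℝ) (c : Fin N → ℝ) (Aa : Fin N → ℝ → ℝ), (∀ (u:(Fin N → ℝ → EuclideanSpace ℝ (Fin 3)) → EuclideanSpace ℝ (Fin 3) → EuclideanSpace ℝ (Fin 3)) (v:EuclideanSpace ℝ (Fin 3) → EuclideanSpace ℝ (Fin 3)) (A:Fin N → (EuclideanSpace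 ℝ (Fin 3) →L[ℝ] EuclideanSpace ℝ (Fin 3))) (T:(Fin N → ℝ → EuclideanSpace ℝ (Fin 3)) → Fin N → ℝ → EuclideanSpace ℝ (Fin 3)), (∀ Z y, u Z y = ∑ k, (Γ*γ k/(4*Real.pi))•∫ σ:ℝ, ((‖y-Z k σ‖^2+Real.exp (-(1+Real.eulerMascheroniConstant-Real.log 2))*Aa k σ)^(3/2:ℝ))⁻¹•cross (deriv (Z k) σ) (y-Z k σ))→(∀ y, v y = u X y+(1/2:ℝ)•y-α•cross (EuclideanSpace.single 2 1) y)→(∀ j, A j = fderiv ℝ v (X j (c j)))→(∀ Z j τ, T Z j τ = (u Z (Z j τ)+(1/2:ℝ)•Z j τ-α•cross (EuclideanSpace.single 2 1) (Z j τ))-(⟪u Z (Z j τ)+(1/2:ℝ)•Z j τ-α•cross (EuclideanSpace.single 2 1) (Z j τ), deriv (Z j) τ⟫_ℝ/‖deriv (Z j) τ‖^2)•deriv (Z j) τ)→(α ≠ 0 ∧ (∀ j, γ j ≠ 0) ∧ (∀ j, ContDiff ℝ 2 (X j) ∧ Differentiable ℝ (w j)∧(∀ τ, ‖deriv (X j)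 τ‖ = 1)∧(∀ τ, ‖iteratedDeriv 2 (X j) τ‖*√Γ≤K) ∧ Tendsto (fun τ => ‖X j τ‖) (cocompact ℝ) atTop) ∧ (∀ j k, j ≠ k → ∀ τ σ, ρ*√Γ≤‖X j τ-X k σ‖) ∧ (∀ j τ σ, ρ*√Γ≤|τ-σ| → cg*ρ*√Γ≤‖X j τ-X j σ‖) ∧ (∀ j τ, cg*|τ-c j|≤Rw*√Γ+‖X j τ‖) ∧ (∀ j τ, w j τ = ⟪v (X j τ), deriv (X j) τ⟫_ℝ) ∧ (∀ j τ, ‖X j τ‖≤Rb*√(Γ*Real.log Γ) → v (X j τ) = w j τ•deriv (X j) τ) ∧ (∀ j, ‖X j (c j)‖≤Rw*√Γ) ∧ (∀ j, |⟪deriv (X j) (c j), EuclideanSpace.single 2 1⟫_ℝ|≤1-θ₀) ∧ (θ₀≤|α| ∧ |α|≤θ₀⁻¹ ∧ ∀ j, θ₀≤|γ j| ∧ |γ j|≤θ₀⁻¹) ∧ (∀ j, w j (c j) = 0 ∧ (∀ τ, w j τ = 0 → τ = c j) ∧ 3/2+δ≤deriv (w j) (c j) ∧ deriv (w j) (c j)≤Λ)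 ∧ (∀ j, Differentiable ℝ (Aa j) ∧ (∀ τ, 0 < Aa j τ) ∧ 1≤KA*Aa j (c j) ∧ ∀ τ, ‖X j τ‖≤2*Rb*√(Γ*Real.log Γ) → Aa j τ = Aa j (c j)) ∧ (∀ j τ, Rw^2*Γ*Aa j τ≤KA*(Rw^2*Γ+‖X j τ‖^2)))) → ((∀ j τ σ, ‖deriv (X j) τ - deriv (X j) σ‖ ≤ Rb) ∧ (∀ j τ, |deriv (w j) τ| ≤ Λ) ∧ (∀ j τ, Λ⁻¹ ≤ Aa j τ)) → (∀ (u:(Fin N → ℝ → EuclideanSpace ℝ (Fin 3)) → EuclideanSpace ℝ (Fin 3) → EuclideanSpace ℝ (Fin 3)) (v:EuclideanSpace ℝ (Fin 3) → EuclideanSpace ℝ (Fin 3)) (A:Fin N → (EuclideanSpace ℝ (Fin 3) →L[ℝ] EuclideanSpace ℝ (Fin 3))) (T:(Fin N → ℝ → EuclideanSpace ℝ (Fin 3)) → Fin N → ℝ → EuclideanSpace ℝ (Fin 3)), (∀ Z y, u Z y = ∑ k, (Γ*γ k/(4*Real.pi))•∫ σ:ℝ, ((‖y-Z k σ‖^2+Real.exp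 (-(1+Real.eulerMascheroniConstant-Real.log 2))*Aa k σ)^(3/2:ℝ))⁻¹•cross (deriv (Z k) σ) (y-Z k σ))→(∀ y, v y = u X y+(1/2:ℝ)•y-α•cross (EuclideanSpace.single 2 1) y)→(∀ j, A j = fderiv ℝ v (X j (c j)))→(∀ Z j τ, T Z j τ = (u Z (Z j τ)+(1/2:ℝ)•Z j τ-α•cross (EuclideanSpace.single 2 1) (Z j τ))-(⟪u Z (Z j τ)+(1/2:ℝ)•Z j τ-α•cross (EuclideanSpace.single 2 1) (Z j τ), deriv (Z j) τ⟫_ℝ/‖deriv (Z j) τ‖^2)•deriv (Z j) τ)→(∃ ψ : Fin N → ℝ → EuclideanSpace ℝ (Fin 3), (∀ j, Continuous (ψ j)) ∧ (0 < ∑ j, ∫ τ in {τ : ℝ | ‖X j τ‖ ≤ Rb*√(Γ*Real.log Γ)}, ‖ψ j τ‖) ∧ (√Γ / cnd * ∑ j, ∫ τ in {τ : ℝ | ‖X j τ‖ ≤ Rb*√(Γ*Real.log Γ)}, ‖ψ j τ‖ ≤ ∑ j, ∫ τ in {τ : ℝ | ‖X j τ‖ ≤ Rb*√(Γ*Real.log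 Γ)}, ⟪ψ j τ, (cross (EuclideanSpace.single 2 1) (X j τ)-⟪cross (EuclideanSpace.single 2 1) (X j τ), deriv (X j) τ⟫_ℝ•deriv (X j) τ)⟫_ℝ) ∧ ∀ Y:Fin N → ℝ → EuclideanSpace ℝ (Fin 3), (∀ j, ContDiff ℝ 2 (Y j))→(∀ j τ, ⟪Y j τ, deriv (X j) τ⟫_ℝ = 0) → (∀ j τ, Rb*√(Γ*Real.log Γ) < ‖X j τ‖ → Y j τ = 0) → ∑ j, ⟪Y j (c j), cross (EuclideanSpace.single 2 1) (X j (c j))⟫_ℝ = 0 → ((∀ j, MeasureTheory.IntegrableOn (fun τ => ⟪ψ j τ, deriv (fun s:ℝ => T (fun k σ => X k σ+s•Y k σ) j τ) 0⟫_ℝ) {τ : ℝ | ‖X j τ‖ ≤ Rb*√(Γ*Real.log Γ)}) ∧ ∑ j, ∫ τ in {τ : ℝ | ‖X j τ‖ ≤ Rb*√(Γ*Real.log Γ)}, ⟪ψ j τ, deriv (fun s:ℝ => T (fun k σ => X k σ+s•Y k σ) j τ) 0⟫_ℝ = 0))))) →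
    ((open Literature.Analysis.FluidPDE in ∀ (N : ℕ) (δ ρ K Λ Rw cg θ₀ KA : ℝ), 0 < N → 0 < δ → 0 < ρ → 0 < Rw → 0 < cg → 0 < θ₀ → ∃ Rb₀ : ℝ, 0 < Rb₀ ∧ ∀ Rb : ℝ, 0 < Rb → Rb ≤ Rb₀ → ∀ b : ℝ, ∃ (cnd Γ₀ : ℝ), 0 < cnd ∧ ∀ Γ : ℝ, Γ₀ ≤ Γ → ∀ (γ : Fin N → ℝ) (α : ℝ) (X : Fin N → ℝ → EuclideanSpace ℝ (Fin 3)) (w : Fin N → ℝ → ℝ) (c : Fin N → ℝ) (Aa : Fin N → ℝ → ℝ), (∀ (u:(Fin N → ℝ → EuclideanSpace ℝ (Fin 3)) → EuclideanSpace ℝ (Fin 3) → EuclideanSpace ℝ (Fin 3)) (v:EuclideanSpace ℝ (Fin 3) → EuclideanSpace ℝ (Fin 3)) (A:Fin N → (EuclideanSpace ℝ (Fin 3) →L[ℝ] EuclideanSpace ℝ (Fin 3))) (T:(Fin N → ℝ → EuclideanSpace ℝ (Fin 3)) → Fin N → ℝ → EuclideanSpace ℝ (Fin 3)), (∀ Z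 y, u Z y = ∑ k, (Γ*γ k/(4*Real.pi))•∫ σ:ℝ, ((‖y-Z k σ‖^2+Real.exp (-(1+Real.eulerMascheroniConstant-Real.log 2))*Aa k σ)^(3/2:ℝ))⁻¹•cross (deriv (Z k) σ) (y-Z k σ))→(∀ y, v y = u X y+(1/2:ℝ)•y-α•cross (EuclideanSpace.single 2 1) y)→(∀ j, A j = fderiv ℝ v (X j (c j)))→(∀ Z j τ, T Z j τ = (u Z (Z j τ)+(1/2:ℝ)•Z j τ-α•cross (EuclideanSpace.single 2 1) (Z j τ))-(⟪u Z (Z j τ)+(1/2:ℝ)•Z j τ-α•cross (EuclideanSpace.single 2 1) (Z j τ), deriv (Z j) τ⟫_ℝ/‖deriv (Z j) τ‖^2)•deriv (Z j) τ)→(α ≠ 0 ∧ (∀ j, γ j ≠ 0) ∧ (∀ j, ContDiff ℝ 2 (X j) ∧ Differentiable ℝ (w j)∧(∀ τ, ‖deriv (X j) τ‖ = 1)∧(∀ τ, ‖iteratedDeriv 2 (X j) τ‖*√Γ≤K) ∧ Tendsto (fun τ => ‖X j τ‖) (cocompact ℝ) atTop) ∧ (∀ j k, j ≠ k → ∀ τ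 σ, ρ*√Γ≤‖X j τ-X k σ‖) ∧ (∀ j τ σ, ρ*√Γ≤|τ-σ| → cg*ρ*√Γ≤‖X j τ-X j σ‖) ∧ (∀ j τ, cg*|τ-c j|≤Rw*√Γ+‖X j τ‖) ∧ (∀ j τ, w j τ = ⟪v (X j τ), deriv (X j) τ⟫_ℝ) ∧ (∀ j τ, ‖X j τ‖≤Rb*√(Γ*Real.log Γ) → v (X j τ) = w j τ•deriv (X j) τ) ∧ (∀ j, ‖X j (c j)‖≤Rw*√Γ) ∧ (∀ j, |⟪deriv (X j) (c j), EuclideanSpace.single 2 1⟫_ℝ|≤1-θ₀) ∧ (θ₀≤|α| ∧ |α|≤θ₀⁻¹ ∧ ∀ j, θ₀≤|γ j| ∧ |γ j|≤θ₀⁻¹) ∧ (∀ j, w j (c j) = 0 ∧ (∀ τ, w j τ = 0 → τ = c j) ∧ 3/2+δ≤deriv (w j) (c j) ∧ deriv (w j) (c j)≤Λ) ∧ (∀ j, Differentiable ℝ (Aa j) ∧ (∀ τ, 0 < Aa j τ) ∧ 1≤KA*Aa j (c j) ∧ ∀ τ, ‖X j τ‖≤2*Rb*√(Γ*Real.log Γ)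 → Aa j τ = Aa j (c j)) ∧ (∀ j τ, Rw^2*Γ*Aa j τ≤KA*(Rw^2*Γ+‖X j τ‖^2)))) → ((∀ j τ σ, ‖deriv (X j) τ - deriv (X j) σ‖ ≤ Rb) ∧ (∀ j τ, |deriv (w j) τ| ≤ Λ) ∧ (∀ j τ, Λ⁻¹ ≤ Aa j τ)) → (∀ (u:(Fin N → ℝ → EuclideanSpace ℝ (Fin 3)) → EuclideanSpace ℝ (Fin 3) → EuclideanSpace ℝ (Fin 3)) (v:EuclideanSpace ℝ (Fin 3) → EuclideanSpace ℝ (Fin 3)) (A:Fin N → (EuclideanSpace ℝ (Fin 3) →L[ℝ] EuclideanSpace ℝ (Fin 3))) (T:(Fin N → ℝ → EuclideanSpace ℝ (Fin 3)) → Fin N → ℝ → EuclideanSpace ℝ (Fin 3)), (∀ Z y, u Z y = ∑ k, (Γ*γ k/(4*Real.pi))•∫ σ:ℝ, ((‖y-Z k σ‖^2+Real.exp (-(1+Real.eulerMascheroniConstant-Real.log 2))*Aa k σ)^(3/2:ℝ))⁻¹•cross (deriv (Z k) σ) (y-Z k σ))→(∀ y, v y = u X y+(1/2:ℝ)•y-α•cross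 (EuclideanSpace.single 2 1) y)→(∀ j, A j = fderiv ℝ v (X j (c j)))→(∀ Z j τ, T Z j τ = (u Z (Z j τ)+(1/2:ℝ)•Z j τ-α•cross (EuclideanSpace.single 2 1) (Z j τ))-(⟪u Z (Z j τ)+(1/2:ℝ)•Z j τ-α•cross (EuclideanSpace.single 2 1) (Z j τ), deriv (Z j) τ⟫_ℝ/‖deriv (Z j) τ‖^2)•deriv (Z j) τ)→(∀ Y:Fin N → ℝ → EuclideanSpace ℝ (Fin 3), (∀ j, ContDiff ℝ 2 (Y j))→(∀ j τ, ⟪Y j τ, deriv (X j) τ⟫_ℝ = 0) → (∀ j τ, Rb*√(Γ*Real.log Γ) < ‖X j τ‖ → Y j τ = 0) → ∑ j, ⟪Y j (c j), cross (EuclideanSpace.single 2 1) (X j (c j))⟫_ℝ = 0 → (∀ j τ, ‖Y j τ‖+‖deriv (Y j) τ‖+‖iteratedDeriv 2 (Y j) τ‖≤(1+|τ-c j|)^b) → ∀ dα L:ℝ, (∀ j τ, ‖X j τ‖≤Rb*√(Γ*Real.log Γ) → ‖deriv (fun s:ℝ => T (fun k σ => X k σ+s•Y k σ) j τ) 0-dα•(cross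 (EuclideanSpace.single 2 1) (X j τ)-⟪cross (EuclideanSpace.single 2 1) (X j τ), deriv (X j) τ⟫_ℝ•deriv (X j) τ)‖≤L) → |dα| * √Γ≤cnd*L)))) := by
  intro hC N δ ρ K Λ Rw cg θ₀ KA hN hδ hρ hRw hcg hθ₀
  obtain ⟨Rb₀, hRb₀, hfam⟩ := hC N δ ρ K Λ Rw cg θ₀ KA hN hδ hρ hRw hcg hθ₀
  refine ⟨Rb₀, hRb₀, fun Rb hRb hRble b => ?_⟩
  obtain ⟨cnd, Γ₀, hcnd, hΓ⟩ := hfam Rb hRb hRble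
  refine ⟨cnd, Γ₀, hcnd, fun Γ hΓle => ?_⟩
  intro γ α X w c Aa hH hNS u v A T hu hv hA hT Y hY2 hYn hYoff hYph _henv dα L hdef
  obtain ⟨ψ, hψc, hMpos, hpair, hann⟩ := hΓ Γ hΓle γ α X w c Aa hH hNS u v A T hu hv hA hT
  obtain ⟨hint, hzero⟩ := hann Y hY2 hYn hYoff hYph
  obtain ⟨-, -, h3, -⟩ := hH u v A T hu hv hA hT
  -- notation
  set ℓ : ℝ := Rb * √(Γ * Real.log Γ) with hℓ
  set S : Fin N → Set ℝ := fun j => {τ : ℝ | ‖X j τ‖ ≤ Rb * √(Γ * Real.log Γ)} with hS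
  set Rcol : Fin N → ℝ → EuclideanSpace ℝ (Fin 3) := fun j τ =>
    cross (EuclideanSpace.single 2 1) (X j τ) - ⟪cross (EuclideanSpace.single 2 1) (X j τ), deriv (X j) τ⟫_ℝ • deriv (X j) τ with hRcol
  set D : Fin N → ℝ → EuclideanSpace ℝ (Fin 3) := fun j τ =>
    deriv (fun s:ℝ => T (fun k σ => X k σ + s • Y k σ) j τ) 0 with hD
  set M : ℝ := ∑ j, ∫ τ in S j, ‖ψ j τ‖ with hM
  set P : ℝ := ∑ j, ∫ τ in S j, ⟪ψ j τ, Rcol j τ⟫_ℝ with hP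
  -- compactness / measurability / integrability on the balls
  have hScpt : ∀ j, IsCompact (S j) := fun j =>
    isCompact_ball_of_cocompact (h3 j).1.continuous (h3 j).2.2.2.2 _
  have hSmeas : ∀ j, MeasurableSet (S j) := fun j => measurableSet_ball (h3 j).1.continuous _
  have hRint : ∀ j, IntegrableOn (fun τ => ⟪ψ j τ, Rcol j τ⟫_ℝ) (S j) := fun j =>
    ((hψc j).inner (continuous_rateColumn (h3 j).1)).continuousOn.integrableOn_compact (hScpt j)
  have hNint : ∀ j, IntegrableOn (fun τ => ‖ψ j τ‖ * L) (S j) := fun j =>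
    ((hψc j).norm.mul continuous_const).continuousOn.integrableOn_compact (hScpt j)
  -- (1) dα·P = Σ ∫ ⟪ψ, dα R − D⟫ (annihilation)
  have h1 : ∑ j, ∫ τ in S j, ⟪ψ j τ, dα • Rcol j τ - D j τ⟫_ℝ = dα * P := by
    have hsplit : ∀ j, ∫ τ in S j, ⟪ψ j τ, dα • Rcol j τ - D j τ⟫_ℝ
        = dα * (∫ τ in S j, ⟪ψ j τ, Rcol j τ⟫_ℝ) - ∫ τ in S j, ⟪ψ j τ, D j τ⟫_ℝ := by
      intro j
      have hcongr : (fun τ => ⟪ψ j τ, dα • Rcol j τ - D j τ⟫_ℝ)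
          = fun τ => dα * ⟪ψ j τ, Rcol j τ⟫_ℝ - ⟪ψ j τ, D j τ⟫_ℝ := by
        funext τ; rw [inner_sub_right, real_inner_smul_right]
      rw [hcongr, integral_sub ((hRint j).const_mul dα) (hint j), integral_const_mul]
    rw [Finset.sum_congr rfl fun j _ => hsplit j, Finset.sum_sub_distrib, hzero, sub_zero, hP, Finset.mul_sum]
  -- (2) |Σ ∫ ⟪ψ, dα R − D⟫| ≤ L·M (in-ball defect bound)
  have h2 : |∑ j, ∫ τ in S j, ⟪ψ j τ, dα • Rcol j τ - D j τ⟫_ℝ| ≤ L * M := by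
    calc |∑ j, ∫ τ in S j, ⟪ψ j τ, dα • Rcol j τ - D j τ⟫_ℝ|
        ≤ ∑ j, |∫ τ in S j, ⟪ψ j τ, dα • Rcol j τ - D j τ⟫_ℝ| := Finset.abs_sum_le_sum_abs _ _
      _ ≤ ∑ j, ∫ τ in S j, ‖ψ j τ‖ * L := by
          refine Finset.sum_le_sum fun j _ => ?_
          rw [← Real.norm_eq_abs]
          refine norm_integral_le_of_norm_le (hNint j) ?_
          refine ae_restrict_of_forall_mem (hSmeas j) fun τ hτ => ?_
          have hd := hdef j τ hτ
          calc ‖⟪ψ j τ, dα • Rcol j τ - D j τ⟫_ℝ‖ ≤ ‖ψ j τ‖ * ‖dα • Rcol j τ - D j τ‖ := norm_inner_le_norm _ _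
            _ ≤ ‖ψ j τ‖ * L := by
                refine mul_le_mul_of_nonneg_left ?_ (norm_nonneg _)
                rw [← norm_neg, neg_sub]
                simpa [hD, hRcol] using hd
      _ = L * M := by
          rw [hM, Finset.mul_sum]
          refine Finset.sum_congr rfl fun j _ => ?_
          rw [integral_mul_const, mul_comm]
  -- (3) conclude
  have hΓ0 : 0 ≤ √Γ / cnd * M := mul_nonneg (div_nonneg (Real.sqrt_nonneg _) hcnd.le) hMpos.le
  have hPpos : 0 ≤ P := le_trans hΓ0 hpair
  have h3' : |dα| * (√Γ / cnd * M) ≤ L * M := by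
    calc |dα| * (√Γ / cnd * M) ≤ |dα| * P := mul_le_mul_of_nonneg_left hpair (abs_nonneg _)
      _ = |dα * P| := by rw [abs_mul, abs_of_nonneg hPpos]
      _ = |∑ j, ∫ τ in S j, ⟪ψ j τ, dα • Rcol j τ - D j τ⟫_ℝ| := by rw [h1]
      _ ≤ L * M := h2
  have h4 : |dα| * √Γ / cnd ≤ L := by
    have h5 : (|dα| * √Γ / cnd) * M ≤ L * M := by
      calc (|dα| * √Γ / cnd) * M = |dα| * (√Γ / cnd * M) := by ring
        _ ≤ L * M := h3'
    exact le_of_mul_le_mul_right h5 hMpos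
  calc |dα| * √Γ = cnd * (|dα| * √Γ / cnd) := by field_simp
    _ ≤ cnd * L := mul_le_mul_of_nonneg_left h4 hcnd.le

end Summit.NavierStokesRegularity.NavierStokesRegularity.Theorems.Clause13RCokernelCertificate

end
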